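import Mathlib
import Literature.MathematicalPhysics.QuantumFieldTheory.Balaban1983to89.B15LatticeCubeTorus

/-!
# `Balaban1983to89.B15LatticeCubeTorusNestedBoxes` — [Balaban1984PropagatorsII] Lemma 2.1 (2.60)–(2.63) with the d-only
# constant c₁″ (reading R0) ON A TORUS WITH ANY NUMBER OF SCALES: the PERIODIC ARRAY OF NESTED BOXES — [IV] p. 179's
# *«rectangular parallelepipeds»* `Z″_n`, `n ≤ C`, repeated in every period cell of the cover of `T = ℤᵈ/∏P_μℤ` — every
# hypothesis of `B15LatticeCubeTorus.lemma21_full_torGeo` DISCHARGED, and every scale `n ≤ C` PRESENT (honest-scope item (iv)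
# of `B15LatticeCubeTorus`: its only periodic witness had two scales, where the one-layer separation is void)

statement-level skeleton of published theorems with citation tags; proofs where landed; nothing here is a claim about the Yang–Mills mass gap

CITATION HEADER (lean-in-tree rule 2026-08-18).  Sources: T. Bałaban, *Propagators and renormalization transformations for
lattice gauge theories. II*, Commun. Math. Phys. **96**, 223–250 (1984) [Balaban1984PropagatorsII] (cell paper B6; PDF held
`paper:balaban1984-cmp96-propagators-rt-ii`, journal page = PDF page + 222; p. 224 [PDF 2], pp. 231–234 [PDF 9–12] read from
the text layer this generation); T. Bałaban, *Propagators and renormalization transformations for lattice gauge theories. I*,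
Commun. Math. Phys. **95**, 17–40 (1984) [Balaban1984PropagatorsI] (B5; p. 17 [PDF 1]: the torus); T. Bałaban, *Large field
renormalization. I*, Commun. Math. Phys. **122**, 175–202 (1989) [Balaban1989LargeFieldI] (B15 = [IV]; p. 179 [PDF 5] re-read
from the text layer `p0005.txt`: the nested `Z″_n`).  WHAT IS REPRODUCED: lit-balaban SKELETON rows **B6.Lem2.1**,
**B6.Eq2.45**/(2.46) (cells; heads unchanged — the printed c₁(α) stays refuted as typed; owner r03, B6-CLOSURE «WHAT IS LEFT
(v) torus wrap-around»), **B15.Eq1.47** geometric input on the torus (owner r12).  Mega-formalization `lit-balaban`, HOME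
`run/shared/lean/pub/lit-balaban/`; Phase-2 proof seat p29 gen 13 (unit `lit-balaban-p29`), free-target protocol G.5-34(d),
sequel to `B15LatticeCubeTorus` v1/v1.1 (p321735/p322851); v1 = p323625 (ACCEPTED ff59f8e659bd), v1.1 = §5 appended (one theorem), v1.2 = §6 appended (one definition with body `interD` + theorems), v1.3 = one theorem appended to §6.  KNITTING — used BY NAME, nothing restated:
`B15LatticeCubeTorus.{pmul, IsPeriodic, isPeriodic_of_top, isPeriodic_of_admissible, TSite, zoneT, proj, torGeo,
lemma21_full_torGeo, lemma21_full_torGeo_admissible, lemma21TwoScale_torGeo_family, periodize, subset_periodize,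
periodize_mem_iff, periodize_univ, periodize_empty, isUnionOfCubes_periodize, cubeIdx_sub_pmul}` (p29 g13),
`B15Ineq147Admissible.subset_of_admissible` (p301778), r11 `B14DomainGeom.{Within, cubeIdx}`, `B14.Eq213MaximalDomains.{side, side_pos}`,
`B15TouchingCubeDomains.{box, boxR, nestedZ, boxR_step, boxR_mono, monotone_nestedZ, layerSepZd_nestedZ, nestedZ_zero,
isUnionOfCubes_box, isUnionOfCubes_diff}` (p315190), `B15TouchingCubeContours.{Tiles, tiles_of_layers, cover_of_exhaustive}`
(p314807), `B15Ineq147LevelGap.{toR, cube, CubeSite, zoneC, LayerSepZd}` (p299858), r11 `B14DomainGeom.IsUnionOfCubes`, pv08/r03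
`B6Lemma21TwoScale.c1TwoScale`, `B6Lemma21Repaired.Ineq26xWith`, `B6RandomWalk.Ineq260`, `B6.Cond259`.

THE PRINTED TEXT.  [IV] p. 179 [PDF 5]: *«… complete these two sets to a sequence Z″_k, Z″_{k−1}, …, Z″_{k−N₀+1} in such a way
that the complements of these sets form an admissible sequence of domains based on partitions into M-cubes in the corresponding
scales. Thus Z″_k, Z″_k∖Z″_{k−1} are unions of M-cubes of the lattice T_η, and Z″_k, Z″_{k−1} are separated by one layer of
M-cubes. Similarly, Z″_{k−1}, Z″_{k−1}∖Z″_{k−2} are unions of L^{−1}M-cubes of this lattice, and Z″_{k−1}, Z″_{k−2} are separated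
by one layer of L^{−1}M-cubes, and so on. … By the definition all components of the domains Z″_j are also rectangular
parallelepipeds»*.  [B6] p. 224 [PDF 2]: *«Ω₁ ⊃ Ω₂ ⊃ … ⊃ Ω_k, Ω_j ⊂ T_η … T = ⋃_{j=0}^k B^j(Λ_j) (2.4) … we admit the case when
some domains Ω_j are equal to T_η»*; p. 234 [PDF 12]: Lemma 2.1 (2.60)–(2.63) (verbatim = docstring of `B6.Lemma21Printed`).
[B5] p. 17 [PDF 1]: *«T_ε … is a d-dimensional torus which we identify with the subset {x ∈ εℤᵈ : −L_μ ≤ x_μ < L_μ, μ = 1, …,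
d} of the lattice εℤᵈ.»*

THE MODEL (ours, declared; scales counted from the bottom as in `B15Ineq147LevelGap`).  In ONE period cell the large-field
family is r12/p29's nested boxes `B15TouchingCubeDomains.nestedZ`: `Z″_n = box r_n = ∏[−r_n, r_n)`, `r_n = M₁K·n·Lⁿ`
(`Z″_0 = ∅`), CAPPED at the scale `C` (`capZ`: `Z″_n = ℤᵈ` for `n > C` — print's *«some domains Ω_j are equal to T_η»*, here
their complements are everything, so the torus has the finitely many scales `0, …, C`); the torus family is its
PERIODIZATION `torusBoxesZ = periodize P (capZ C nestedZ)` — the union of the deck translates `Z″_n + P·v`, `v ∈ ℤᵈ`, i.e. the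
pull-back to the cover of the array of nested boxes drawn on `T`.  THE MECHANISM: (a) nesting and the deck invariance are
formal (`monotone_periodize`, `periodize_mem_iff`); (b) the ONE-LAYER SEPARATION `LayerSepZd … (M₁K) L` SURVIVES PERIODIZATION
WITH NO CONDITION ON THE PERIODS (`layerSepZd_periodize`): a point outside the periodized `Z″_{n+1}` is outside EVERY translate
of `Z″_{n+1}`, in particular outside the translate of the cell containing the given point of `Z″_n`, and the sup distance is
translation invariant — so the cell's separation `layerSepZd_nestedZ` applies verbatim (overlapping translates only shrink the
set of constrained pairs); (c) the layers are unions of the scale-`n` cubes as soon as the cube sides divide the periods,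
`M₁L^C ∣ P_μ` (`isUnionOfCubes_periodize`: the deck translations permute the partition cubes; a box `box r_m`, `m ≥ n`, is a
union of `M₁Lⁿ`-cubes since `M₁Lⁿ ∣ r_m`); (d) the covering (2.4) from `Z″_0 = ∅`, `Z″_{C+1} = ℤᵈ` (`tiles_of_layers`,
`cover_of_exhaustive`); (e) PRESENCE OF EVERY SCALE `n ≤ C` when `P_μ > 2r_C + M₁L^C`: the cube `[r_n, r_n + M₁Lⁿ) ×
[0, M₁Lⁿ)^{d−1}` on the face of `box r_n` lies in `box r_{n+1}` of its own cell (`r_n + M₁Lⁿ ≤ r_{n+1}`, `boxR_step`) and in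
NO translate of `box r_n` (its own: first coordinate `≥ r_n`; any other is farther than `P_μ − r_n − M₁Lⁿ > r_n` in the
coordinate where the translation acts), and projects to a torus cube-site of zone `n` (`proj`).

WHAT THIS FILE PROVES (kernel-checked, zero `sorry`; definitions with bodies `capZ`, `torusBoxesZ`, `scaleIdx`, `interD`; theorems
otherwise; no named fact, no hypothesis structure of its own; axioms standard).
§1 periodizing a nested LARGE-FIELD family: `monotone_periodize`, **`layerSepZd_periodize`** (no condition on the periods),
   `isUnionOfCubes_layer_periodize`, `exhaustive_periodize`.
§2 capping: `capZ`, `capZ_of_le`/`_of_gt`, `monotone_capZ`, `layerSepZd_capZ`.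
§3 the periodic array of nested boxes `torusBoxesZ M₁ K L C P`: `isUnionOfCubes_nestedZ_of_le`, `monotone_torusBoxesZ`,
   **`layerSepZd_torusBoxesZ`** (`M = M₁K`), `torusBoxesZ_top`/`_zero`, **`layers_torusBoxesZ`**, **`tiles_torusBoxesZ`**,
   **`isPeriodic_torusBoxesZ`**, and **`lemma21_full_torGeo_nestedBoxes`**: all four displays (2.60)–(2.63) with c₁″ on the
   torus cube carrier of this family, from NUMERICS ONLY — `d ≥ 1` (`[NeZero d]`), `M₁ ≥ 1`, `K ≥ 2`, `L ≥ 2`, any cap `C`,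
   periods `P_μ ≥ 1` with `M₁L^C ∣ P_μ`, `R·M_r ≤ K`, `δ₀ > 0`, 0 < α < 1, (2.59).
§4 **`cube_scaleIdx_subset_layer`**, **`exists_tsite_of_scale`**: for `P_μ > 2r_C + M₁L^C` every scale `n ≤ C` is the zone of
   some torus cube-site — for `C ≥ 2` three or more nested scales in every period cell, the one-layer separation exercised
   non-vacuously on a torus (what `B15LatticeCubeTorus` HONEST SCOPE (iv) recorded as not constructed).
§5 (v1.1, append-only) **`lemma21TwoScale_torGeo_nestedBoxes_family`**: ONE constant c₁″(α) over the family of ALL these tori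
   and ALL caps — print's index `(k, T_η)` —, `M₁, K, L, R, M_r` free to vary with the index (the shape consumed by
   `DagBinding.b6Lemma21Param_of_twoScale`, via `B15LatticeCubeTorus.lemma21TwoScale_torGeo_family`).
§6 (v1.2, append-only) THE FAITHFUL TRANSFER FOR ANY [III] (2.13)-ADMISSIBLE COVER SEQUENCE: **`interD`** (intersect the deck
   translates of the domains; complements = the periodized large-field sets, `compl_interD`; no large-field point of the cover
   lost, `interD_subset`), `interD_mem_iff`, `hdistD_interD`, `isUnionOfCubes_interD(_admissible)`, `interD_univ`/`_empty`,
   `isPeriodic_interD`, **`lemma21_full_torGeo_interD`** — hypotheses verbatim those of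
   `B15LatticeCubeTorus.lemma21_full_torGeo_periodize` (r11's `hdistD`, cube unions, `Ω₀ = T`, `Ω_{K+1} = ∅`, `L^K·M ∣ P_μ`,
   `1 ≤ M₁ ∣ M`, `L ≥ 2`, `R·M_r ≤ M/M₁`, `2 ≤ M/M₁`), conclusion on the torus whose large fields are the cover's, periodized;
   (v1.3) **`exists_tsite_interD_of_cubeSite`**: every cover cube-site whose non-trivial translates lie in `Ω_n` survives as a
   torus cube-site of the same zone (faithfulness as a theorem).
A RIDER ON `B15LatticeCubeTorus` §6 (recorded here so that file is not touched again).  `periodize` is the pull-back of the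
IMAGE under the covering map.  Applied, as in `lemma21_full_torGeo_periodize`, to a family of DOMAINS `Ω_n` of the cover it is
faithful for domains drawn inside one period cell (bounded motifs: a periodic array of nested small-field domains, all scales
kept), but for a domain containing the complement of a bounded set — the typical small-field region of an infinite-volume
configuration, e.g. the complements of `nestedZ` or r11's `maxDom` output for bounded large fields — the image is ALL of `T`
(every point has a far translate inside `Ω_n`), the torus family `(periodize Ω_n)ᶜ` is `∅, …, ∅, T` and the torus has ONE
scale: that theorem is correct as stated and then void of multi-scale content.  For such covers the faithful transfer
periodizes the LARGE-FIELD sets `Z″_n = Ω_nᶜ` (bounded) — equivalently intersects, rather than unites, the deck translates of the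
domains — which is what this file does for the nested boxes (§3) and, since v1.2, for EVERY [III]-admissible cover sequence
(§6 `lemma21_full_torGeo_interD`, same hypotheses as `lemma21_full_torGeo_periodize`); (b) above is the reason no admissibility
margin is lost.
HONEST SCOPE.  (i) Contour reading R0 and the corrected d-only constant c₁″ under (2.59) are inherited from the cover files
(the printed 12c₀(½α)^d stays refuted as typed); `M = M₁K`, `K ≥ 2` is the cover's `2 ≤ M/M₁`.  (ii) The boxes are centred at
the origin of each period cell and cubical (print's components are general rectangular parallelepipeds produced by the
inductive construction (1.11)–(1.12), not reproduced); the family is a MODEL on which every hypothesis of the torus Lemma 2.1 is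
discharged by arithmetic, not print's `Z″` of a given field configuration.  (iii) Presence of all scales needs the period to
exceed the largest box (`P_μ > 2r_C + M₁L^C`), as it must; Lemma 2.1 itself holds for every admissible period.  (iv) Finite
lattice geometry feeding the bookkeeping Lemma 2.1 of a published proof as repaired in the tree; NOT the printed constant, NOT
progress on any Clay problem.
-/

namespace Literature.MathematicalPhysics.QuantumFieldTheory.Balaban1983to89.B15LatticeCubeTorusNestedBoxes

open Literature.MathematicalPhysics.QuantumFieldTheory.Balaban1983to89
open B6Geometry B15Ineq147LevelGap B15Ineq147Admissible B14DomainGeom B15TouchingCubeContours B15TouchingCubeDomains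
  B15LatticeCubeContours B15LatticeCubeTorus

variable {d : ℕ} {P : Fin d → ℕ} {Z : ℕ → Set (Fin d → ℤ)}

/-! ## §1 Periodizing a nested LARGE-FIELD family `Z″`: nesting, the one-layer separation and the cube structure survive -/

/-- The periodization of a nested family is nested. [cite: Balaban1989LargeFieldI, (1.11) p.179; Balaban1984PropagatorsI, Sect. A p.17] -/
theorem monotone_periodize (hmono : Monotone Z) : Monotone (periodize P Z) :=
  fun _ _ hmn _ ⟨v, hv⟩ => ⟨v, hmono hmn hv⟩

/-- The sup distance of lattice points is translation invariant. [folklore] -/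
private theorem dist_toR_sub (a b t : Fin d → ℤ) : dist (toR (a - t)) (toR (b - t)) = dist (toR a) (toR b) := by
  have e : ∀ x : Fin d → ℤ, toR (x - t) = toR x - toR t := fun x => by
    funext μ; simp [toR]
  rw [e, e, dist_sub_right]

/-- **THE ONE-LAYER SEPARATION SURVIVES PERIODIZATION OF THE LARGE-FIELD FAMILY** — with NO condition on the periods: a point
outside the periodized `Z″_{n+1}` is outside EVERY translate, in particular outside the translate containing the given point of
`Z″_n`, so the same-cell separation applies. [cite: Balaban1989LargeFieldI, p.179; Balaban1984PropagatorsI, Sect. A p.17] -/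
theorem layerSepZd_periodize {M L : ℕ} (hsep : LayerSepZd Z M L) : LayerSepZd (periodize P Z) M L := by
  rintro n a b ⟨v, hv⟩ hb
  have hb' : b - pmul P v ∉ Z (n + 1) := fun h => hb ⟨v, h⟩
  have := hsep hv hb'
  rwa [dist_toR_sub] at this

/-- The layers of the periodized family are unions of the scale-`n` cubes when `Z″_{n+1}` and `Z″_n` are and the cube side divides
the periods. [cite: Balaban1989LargeFieldI, p.179] -/
theorem isUnionOfCubes_layer_periodize {s : ℕ} (hs : ∀ μ, s ∣ P μ) (hs0 : 0 < s) {n : ℕ}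
    (h1 : IsUnionOfCubes s (Z (n + 1))) (h0 : IsUnionOfCubes s (Z n)) :
    IsUnionOfCubes s (periodize P Z (n + 1) \ periodize P Z n) :=
  isUnionOfCubes_diff (isUnionOfCubes_periodize hs hs0 h1) (isUnionOfCubes_periodize hs hs0 h0)

/-- The periodized family exhausts the lattice when the original one does. [cite: Balaban1984PropagatorsII, (2.4) p.224] -/
theorem exhaustive_periodize (hex : ∀ x, ∃ n, x ∈ Z n) (x : Fin d → ℤ) : ∃ n, x ∈ periodize P Z n := by
  obtain ⟨n, hn⟩ := hex x
  exact ⟨n, subset_periodize n hn⟩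

/-! ## §2 Capping a nested family at the scale `C` (finitely many scales, as on the finite torus) -/

/-- The capped family: `Z″_n` for `n ≤ C`, the whole lattice above (*«we admit the case when some domains Ω_j are equal to T_η»*:
their complements `Z″` are then everything). [cite: Balaban1984PropagatorsII, (2.1)–(2.4) p.224] -/
def capZ (C : ℕ) (Z : ℕ → Set (Fin d → ℤ)) : ℕ → Set (Fin d → ℤ) := fun n => if n ≤ C then Z n else Set.univ

/-- Below the cap nothing changes. [cite: Balaban1984PropagatorsII, (2.1) p.224] -/
theorem capZ_of_le {C n : ℕ} (hn : n ≤ C) : capZ C Z n = Z n := by simp [capZ, hn]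

/-- Above the cap everything. [cite: Balaban1984PropagatorsII, (2.1) p.224] -/
theorem capZ_of_gt {C n : ℕ} (hn : C < n) : capZ C Z n = Set.univ := by simp [capZ, show ¬ n ≤ C by omega]

/-- Capping preserves nesting. [cite: Balaban1989LargeFieldI, (1.11) p.179] -/
theorem monotone_capZ {C : ℕ} (hmono : Monotone Z) : Monotone (capZ C Z) := by
  intro m n hmn x hx
  rcases Nat.lt_or_ge C n with h | h
  · rw [capZ_of_gt h]; trivial
  · rw [capZ_of_le h]
    rw [capZ_of_le (le_trans hmn h)] at hx
    exact hmono hmn hx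

/-- Capping preserves the one-layer separation (the new top member is everything, so no pair is constrained there).
[cite: Balaban1989LargeFieldI, p.179] -/
theorem layerSepZd_capZ {C M L : ℕ} (hsep : LayerSepZd Z M L) : LayerSepZd (capZ C Z) M L := by
  intro n a b ha hb
  rcases Nat.lt_or_ge C (n + 1) with h | h
  · rw [capZ_of_gt h] at hb
    exact (hb trivial).elim
  · rw [capZ_of_le h] at hb
    rw [capZ_of_le (by omega)] at ha
    exact hsep ha hb

/-! ## §3 The periodic array of nested boxes: a torus with `C + 1` scales, every hypothesis of the torus Lemma 2.1 discharged -/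

variable {M₁ K L C : ℕ}

/-- A box of the nested family is a union of the cubes of every scale `n` up to its own. [cite: Balaban1989LargeFieldI, p.179] -/
theorem isUnionOfCubes_nestedZ_of_le (hM₁ : 0 < M₁) (hL : 1 ≤ L) {n m : ℕ} (hnm : n ≤ m) :
    IsUnionOfCubes (M₁ * L ^ n) (nestedZ (d := d) M₁ K L m) := by
  have hs : 0 < M₁ * L ^ n := Nat.mul_pos hM₁ (Nat.pow_pos (by omega))
  have hpow : L ^ m = L ^ n * L ^ (m - n) := by rw [← pow_add, Nat.add_sub_cancel' hnm]
  have e : boxR M₁ K L m = M₁ * L ^ n * (K * m * L ^ (m - n)) := by unfold boxR; rw [hpow]; ring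
  unfold nestedZ
  rw [e]
  exact isUnionOfCubes_box hs _

/-- **THE PERIODIC ARRAY OF NESTED BOXES**: the large-field family of the cover of a torus with periods `P_μ` — in every period cell
the nested boxes `Z″_n = box(M₁K·n·Lⁿ)`, `n ≤ C`, and `Z″_n = ℤᵈ` above `C`. [cite: Balaban1989LargeFieldI, p.179; Balaban1984PropagatorsII, (2.1)–(2.4) p.224; Balaban1984PropagatorsI, Sect. A p.17] -/
def torusBoxesZ (M₁ K L C : ℕ) (P : Fin d → ℕ) : ℕ → Set (Fin d → ℤ) := periodize P (capZ C (nestedZ M₁ K L))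

/-- It is nested. [cite: Balaban1989LargeFieldI, (1.11) p.179] -/
theorem monotone_torusBoxesZ (hL : 1 ≤ L) : Monotone (torusBoxesZ (d := d) M₁ K L C P) :=
  monotone_periodize (monotone_capZ (monotone_nestedZ hL))

/-- It has the one-layer separation with `M = M₁K`. [cite: Balaban1989LargeFieldI, p.179] -/
theorem layerSepZd_torusBoxesZ (hL : 1 ≤ L) : LayerSepZd (torusBoxesZ (d := d) M₁ K L C P) (M₁ * K) L :=
  layerSepZd_periodize (layerSepZd_capZ (layerSepZd_nestedZ hL))

/-- Its top member is everything. [cite: Balaban1984PropagatorsII, (2.1)–(2.4) p.224] -/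
theorem torusBoxesZ_top {n : ℕ} (hn : C < n) : torusBoxesZ (d := d) M₁ K L C P n = Set.univ :=
  periodize_univ (capZ_of_gt hn)

/-- Its bottom member is empty (`d ≥ 1`). [cite: Balaban1984PropagatorsII, (2.1)–(2.4) p.224] -/
theorem torusBoxesZ_zero (hd : 0 < d) : torusBoxesZ (d := d) M₁ K L C P 0 = ∅ :=
  periodize_empty (by rw [capZ_of_le (Nat.zero_le C)]; exact nestedZ_zero hd)

/-- **Its layers are unions of the cubes of the corresponding scale** (`M₁ ≥ 1`, `L ≥ 1`, `M₁L^C ∣ P_μ`).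
[cite: Balaban1989LargeFieldI, p.179] -/
theorem layers_torusBoxesZ (hM₁ : 0 < M₁) (hL : 1 ≤ L) (hdvd : ∀ μ, M₁ * L ^ C ∣ P μ) (n : ℕ) :
    IsUnionOfCubes (M₁ * L ^ n) (torusBoxesZ (d := d) M₁ K L C P (n + 1) \ torusBoxesZ M₁ K L C P n) := by
  have hs : 0 < M₁ * L ^ n := Nat.mul_pos hM₁ (Nat.pow_pos (by omega))
  have htriv : IsUnionOfCubes (M₁ * L ^ n) (Set.univ : Set (Fin d → ℤ)) := fun _ _ _ => by simp
  rcases Nat.lt_or_ge C n with h | h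
  · -- both members are everything
    unfold torusBoxesZ
    rw [periodize_univ (capZ_of_gt (Nat.lt_succ_of_lt h)), periodize_univ (capZ_of_gt h)]
    exact isUnionOfCubes_diff htriv htriv
  · have hsdvd : ∀ μ, M₁ * L ^ n ∣ P μ := fun μ => (Nat.mul_dvd_mul_left M₁ (Nat.pow_dvd_pow L h)).trans (hdvd μ)
    refine isUnionOfCubes_layer_periodize hsdvd hs ?_ ?_
    · rcases Nat.lt_or_ge C (n + 1) with h1 | h1
      · rw [capZ_of_gt h1]; exact htriv
      · rw [capZ_of_le h1]; exact isUnionOfCubes_nestedZ_of_le hM₁ hL (Nat.le_succ n)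
    · rw [capZ_of_le h]; exact isUnionOfCubes_nestedZ_of_le hM₁ hL le_rfl

/-- **The covering (2.4)** for the periodic array of nested boxes (`d, M₁ ≥ 1`, `L ≥ 1`, `M₁L^C ∣ P_μ`).
[cite: Balaban1984PropagatorsII, (2.4) p.224; Balaban1989LargeFieldI, p.179] -/
theorem tiles_torusBoxesZ (hd : 0 < d) (hM₁ : 0 < M₁) (hL : 1 ≤ L) (hdvd : ∀ μ, M₁ * L ^ C ∣ P μ) :
    Tiles M₁ L (torusBoxesZ (d := d) M₁ K L C P) :=
  tiles_of_layers hM₁ (by omega) (layers_torusBoxesZ hM₁ hL hdvd)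
    (cover_of_exhaustive (torusBoxesZ_zero hd) fun x => ⟨C + 1, by rw [torusBoxesZ_top (Nat.lt_succ_self C)]; trivial⟩)

/-- **It is the pull-back of a torus family** (`IsPeriodic`): invariant under the deck translations, finitely many scales, cube
sides dividing the periods. [cite: Balaban1984PropagatorsII, (2.1)–(2.4) p.224; Balaban1984PropagatorsI, Sect. A p.17] -/
theorem isPeriodic_torusBoxesZ (hM₁ : 0 < M₁) (hL : 1 ≤ L) (hP : ∀ μ, 0 < P μ) (hdvd : ∀ μ, M₁ * L ^ C ∣ P μ) :
    IsPeriodic M₁ L (torusBoxesZ (d := d) M₁ K L C P) P :=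
  isPeriodic_of_top (K := C) (monotone_torusBoxesZ hL) hM₁ (by omega) hP (fun n x v => periodize_mem_iff n x v)
    (torusBoxesZ_top (Nat.lt_succ_self C)) hdvd

variable [NeZero d]

/-- **LEMMA 2.1 (2.60)–(2.63) WITH c₁″ ON THE TORUS OF THE PERIODIC NESTED BOXES — NUMERICS ONLY, ANY NUMBER OF SCALES**
(`d ≥ 1`, `M₁ ≥ 1`, `K ≥ 2`, `L ≥ 2`, any cap `C`, positive periods with `M₁L^C ∣ P_μ`, `R·M_r ≤ K`, `δ₀ > 0`, 0 < α < 1,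
(2.59)): every hypothesis of `B15LatticeCubeTorus.lemma21_full_torGeo` discharged on a named periodic family whose one-layer
separation is NOT void (for `C ≥ 2` three or more scales are nested in every period cell) — the honest-scope item (iv) of
`B15LatticeCubeTorus`. [cite: Balaban1984PropagatorsII, Lemma 2.1 (2.60)–(2.63) p.234, (2.1)–(2.4) p.224; Balaban1984PropagatorsI, Sect. A p.17; Balaban1989LargeFieldI, p.179; corrected] -/
theorem lemma21_full_torGeo_nestedBoxes (hM₁ : 0 < M₁) (hK : 2 ≤ K) (hL : 2 ≤ L) (hP : ∀ μ, 0 < P μ)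
    (hdvd : ∀ μ, M₁ * L ^ C ∣ P μ)
    (F : Finset (TSite M₁ L (torusBoxesZ (d := d) M₁ K L C P) P)) (kk : ℕ) (η R Mr : ℝ) (hRM : R * Mr ≤ (K : ℝ))
    {δ₀ : ℝ} (hδ : 0 < δ₀) :
    ∀ α : ℝ, 0 < α → α < 1 → B6.Cond259 d δ₀ α R Mr →
      B6RandomWalk.Ineq260 (torGeo (isPeriodic_torusBoxesZ hM₁ (by omega) hP hdvd) F kk η R Mr) δ₀ α ∧
        B6Lemma21Repaired.Ineq261With (B6Lemma21TwoScale.c1TwoScale d δ₀ α)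
          (torGeo (isPeriodic_torusBoxesZ hM₁ (by omega) hP hdvd) F kk η R Mr) δ₀ α ∧
        B6Lemma21Repaired.Ineq262With (B6Lemma21TwoScale.c1TwoScale d δ₀ α)
          (torGeo (isPeriodic_torusBoxesZ hM₁ (by omega) hP hdvd) F kk η R Mr) δ₀ α ∧
        B6Lemma21Repaired.Ineq263With (B6Lemma21TwoScale.c1TwoScale d δ₀ α)
          (torGeo (isPeriodic_torusBoxesZ hM₁ (by omega) hP hdvd) F kk η R Mr) δ₀ α := by
  have hd : 0 < d := Nat.pos_of_ne_zero (NeZero.ne d)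
  have hdiv : M₁ * K / M₁ = K := Nat.mul_div_cancel_left K hM₁
  refine lemma21_full_torGeo _ (M := M₁ * K) (monotone_torusBoxesZ (by omega)) (layerSepZd_torusBoxesZ (by omega))
    (tiles_torusBoxesZ hd hM₁ (by omega) hdvd) hM₁ (Nat.le_mul_of_pos_right M₁ (by omega)) hL ?_ ?_ hδ
  · rw [hdiv]; exact hRM
  · rw [hdiv]; exact hK

/-! ## §4 Every scale `n ≤ C` is present on the torus when the periods exceed the largest box -/

/-- The index `(K·n, 0, …, 0)` of the witness cube of scale `n`: the cube `[r_n, r_n + M₁Lⁿ) × [0, M₁Lⁿ)^{d-1}` sitting on the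
face of the box `Z″_n = box r_n`, `r_n = M₁K·n·Lⁿ`, inside `Z″_{n+1}`. [cite: Balaban1989LargeFieldI, p.179] -/
def scaleIdx (K n : ℕ) : Fin d → ℤ := Pi.single 0 ((K * n : ℕ) : ℤ)

/-- Coordinates of the points of the witness cube: all in `[0, r_n + M₁Lⁿ)`, the first one `≥ r_n`. [cite: Balaban1989LargeFieldI, p.179] -/
private theorem bounds_of_mem_cube_scaleIdx {n : ℕ} {x : Fin d → ℤ} (hx : x ∈ cube M₁ L n (scaleIdx K n)) :
    (∀ μ, 0 ≤ x μ ∧ x μ < (boxR M₁ K L n : ℤ) + (M₁ * L ^ n : ℕ)) ∧ (boxR M₁ K L n : ℤ) ≤ x 0 := by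
  have er : (boxR M₁ K L n : ℤ) = ((M₁ * L ^ n : ℕ) : ℤ) * ((K * n : ℕ) : ℤ) := by unfold boxR; push_cast; ring
  have hs0 : (0 : ℤ) ≤ ((M₁ * L ^ n : ℕ) : ℤ) := by exact_mod_cast Nat.zero_le _
  have hKn : (0 : ℤ) ≤ ((K * n : ℕ) : ℤ) := by exact_mod_cast Nat.zero_le _
  refine ⟨fun μ => ?_, ?_⟩
  · obtain ⟨h1, h2⟩ := hx μ
    by_cases hμ : μ = 0
    · subst hμ
      rw [scaleIdx, Pi.single_eq_same] at h1 h2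
      constructor
      · exact le_trans (mul_nonneg hs0 hKn) h1
      · rw [er]; linarith
    · rw [scaleIdx, Pi.single_eq_of_ne hμ] at h1 h2
      constructor
      · linarith
      · rw [er]; nlinarith
  · have h1 := (hx 0).1
    rw [scaleIdx, Pi.single_eq_same] at h1
    rwa [er]

/-- **The witness cube of scale `n ≤ C` lies in the layer `Z″_{n+1}∖Z″_n` of the periodic array of nested boxes** when every
period exceeds `2r_C + M₁L^C` (`M₁, K, L ≥ 1`): it lies in the box `Z″_{n+1}` of its own period cell (`r_n + M₁Lⁿ ≤ r_{n+1}`), and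
in NO translate of the box `Z″_n` (its own: first coordinate `≥ r_n`; the others are farther than `P_μ − r_n − M₁Lⁿ > r_n`).
[cite: Balaban1989LargeFieldI, p.179; Balaban1984PropagatorsII, (2.1)–(2.4) p.224; Balaban1984PropagatorsI, Sect. A p.17] -/
theorem cube_scaleIdx_subset_layer (hK : 1 ≤ K) (hL : 1 ≤ L)
    (hbig : ∀ μ, 2 * boxR M₁ K L C + M₁ * L ^ C < P μ) {n : ℕ} (hn : n ≤ C) :
    cube M₁ L n (scaleIdx K n) ⊆ torusBoxesZ (d := d) M₁ K L C P (n + 1) \ torusBoxesZ M₁ K L C P n := by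
  intro x hx
  obtain ⟨hxb, hx0⟩ := bounds_of_mem_cube_scaleIdx hx
  have hsK : M₁ * L ^ n ≤ M₁ * K * L ^ (n + 1) := by
    calc M₁ * L ^ n = M₁ * 1 * L ^ n := by ring
      _ ≤ M₁ * K * L ^ (n + 1) :=
        Nat.mul_le_mul (Nat.mul_le_mul_left M₁ hK) (pow_le_pow_right₀ hL (Nat.le_succ n))
  constructor
  · -- in `Z″_{n+1}` of its own cell (or everything, at the top)
    rcases Nat.lt_or_ge C (n + 1) with h | h
    · rw [torusBoxesZ_top h]; trivial
    · unfold torusBoxesZ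
      refine subset_periodize (n + 1) ?_
      rw [capZ_of_le h]
      have hstep : (boxR M₁ K L n : ℤ) + (M₁ * L ^ n : ℕ) ≤ (boxR M₁ K L (n + 1) : ℤ) := by
        have := boxR_step (M₁ := M₁) (K := K) hL n
        exact_mod_cast le_trans (Nat.add_le_add_left hsK _) this
      intro μ
      obtain ⟨h1, h2⟩ := hxb μ
      have hr : (0 : ℤ) ≤ (boxR M₁ K L (n + 1) : ℤ) := by exact_mod_cast Nat.zero_le _
      exact ⟨by linarith, by linarith⟩
  · -- in no translate of `Z″_n`
    rintro ⟨v, hv⟩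
    unfold capZ at hv
    rw [if_pos hn] at hv
    have hbig' : ∀ μ, 2 * (boxR M₁ K L n : ℤ) + (M₁ * L ^ n : ℕ) < P μ := fun μ => by
      have h1 : boxR M₁ K L n ≤ boxR M₁ K L C := boxR_mono hL hn
      have h2 : M₁ * L ^ n ≤ M₁ * L ^ C := Nat.mul_le_mul_left M₁ (pow_le_pow_right₀ hL hn)
      have h3 := hbig μ
      push_cast
      exact_mod_cast (by omega : 2 * boxR M₁ K L n + M₁ * L ^ n < P μ)
    have hv0 : ∀ μ, v μ = 0 := by
      intro μ
      obtain ⟨h1, h2⟩ := hv μ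
      simp only [Pi.sub_apply, pmul] at h1 h2
      obtain ⟨h3, h4⟩ := hxb μ
      have hp := hbig' μ
      have hP0 : (0 : ℤ) ≤ (P μ : ℤ) := by exact_mod_cast Nat.zero_le _
      rcases le_or_gt (v μ) (-1) with ht | ht
      · have : (P μ : ℤ) * v μ ≤ (P μ : ℤ) * (-1) := mul_le_mul_of_nonneg_left ht hP0
        linarith
      rcases le_or_gt 1 (v μ) with ht' | ht'
      · have : (P μ : ℤ) * 1 ≤ (P μ : ℤ) * v μ := mul_le_mul_of_nonneg_left ht' hP0
        linarith
      omega
    have h2 := (hv 0).2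
    simp only [Pi.sub_apply, pmul, hv0 0, mul_zero, sub_zero] at h2
    exact absurd h2 (not_lt.mpr hx0)

/-- **EVERY SCALE `n ≤ C` IS PRESENT ON THE TORUS OF THE PERIODIC NESTED BOXES** (`M₁, K, L ≥ 1`, `M₁L^C ∣ P_μ`,
`P_μ > 2r_C + M₁L^C`): there is a torus cube-site of zone `n` — so for `C ≥ 2` the family of
`lemma21_full_torGeo_nestedBoxes` nests three or more scales in every period cell and its one-layer separation hypothesis is
not void (honest-scope item (iv) of `B15LatticeCubeTorus`, whose only periodic witness had two scales).
[cite: Balaban1989LargeFieldI, p.179; Balaban1984PropagatorsII, (2.1)–(2.4), (2.45) pp.224, 231; Balaban1984PropagatorsI, Sect. A p.17] -/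
theorem exists_tsite_of_scale (hM₁ : 0 < M₁) (hK : 1 ≤ K) (hL : 1 ≤ L) (hdvd : ∀ μ, M₁ * L ^ C ∣ P μ)
    (hbig : ∀ μ, 2 * boxR M₁ K L C + M₁ * L ^ C < P μ) {n : ℕ} (hn : n ≤ C) :
    ∃ a : TSite M₁ L (torusBoxesZ (d := d) M₁ K L C P) P, zoneT a = n := by
  have hP : ∀ μ, 0 < P μ := fun μ => lt_of_le_of_lt (Nat.zero_le _) (hbig μ)
  exact ⟨proj (isPeriodic_torusBoxesZ hM₁ hL hP hdvd) ⟨(n, scaleIdx K n), cube_scaleIdx_subset_layer hK hL hbig hn⟩, rfl⟩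

/-! ## §5 (v1.1, append-only) ONE constant over ALL tori and ALL numbers of scales: the family form -/

section Family

variable {I : Type}

/-- **LEMMA 2.1 (TWO-SCALE CONSTANT) UNIFORMLY OVER THE FAMILY OF ALL PERIODIC NESTED-BOX TORI** — print's index `(k, T_η)` =
(cap `C i`, periods `P i`), with `M₁, K, L, R, M_r` free to vary with the index as well: ONE constant c₁″(α) for the whole
family, every geometric hypothesis discharged from numerics (`M₁ ≥ 1`, `K ≥ 2`, `L ≥ 2`, `M₁L^C ∣ P_μ`, `R·M_r ≤ K`,
`δ₀ > 0`) — the shape consumed by `DagBinding.b6Lemma21Param_of_twoScale`. [cite: Balaban1984PropagatorsII, Lemma 2.1 (2.60)–(2.61) p.234, (2.1)–(2.4) p.224; Balaban1984PropagatorsI, Sect. A p.17; Balaban1989LargeFieldI, p.179; corrected] -/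
theorem lemma21TwoScale_torGeo_nestedBoxes_family {δ₀ : ℝ} (hδ : 0 < δ₀) (M₁ K L C : I → ℕ) (P : I → Fin d → ℕ)
    (h : ∀ i, IsPeriodic (M₁ i) (L i) (torusBoxesZ (d := d) (M₁ i) (K i) (L i) (C i) (P i)) (P i))
    (hM₁ : ∀ i, 0 < M₁ i) (hK : ∀ i, 2 ≤ K i) (hL : ∀ i, 2 ≤ L i) (hdvd : ∀ i μ, M₁ i * L i ^ C i ∣ P i μ)
    (F : ∀ i, Finset (TSite (M₁ i) (L i) (torusBoxesZ (d := d) (M₁ i) (K i) (L i) (C i) (P i)) (P i)))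
    (kk : I → ℕ) (η R Mr : I → ℝ) (hRM : ∀ i, R i * Mr i ≤ (K i : ℝ)) :
    B6Lemma21TwoScale.Lemma21TwoScale d δ₀ (fun i => torGeo (h i) (F i) (kk i) (η i) (R i) (Mr i)) := by
  have hd : 0 < d := Nat.pos_of_ne_zero (NeZero.ne d)
  have hL1 : ∀ i, 1 ≤ L i := fun i => le_trans (by norm_num) (hL i)
  have hdiv : ∀ i, M₁ i * K i / M₁ i = K i := fun i => Nat.mul_div_cancel_left (K i) (hM₁ i)
  refine lemma21TwoScale_torGeo_family hδ M₁ L (fun i => M₁ i * K i) _ P h F kk η R Mr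
    (fun i => monotone_torusBoxesZ (hL1 i)) (fun i => layerSepZd_torusBoxesZ (hL1 i))
    (fun i => tiles_torusBoxesZ hd (hM₁ i) (hL1 i) (hdvd i)) hM₁
    (fun i => Nat.le_mul_of_pos_right (M₁ i) (le_trans (by norm_num) (hK i))) hL ?_ ?_
  · intro i; rw [hdiv]; exact hRM i
  · intro i; rw [hdiv]; exact hK i

end Family

/-! ## §6 (v1.2, append-only) THE FAITHFUL TRANSFER FOR ANY [III]-ADMISSIBLE COVER SEQUENCE: intersect the deck translates
of the domains (= periodize the large-field sets), then `B15LatticeCubeTorus.lemma21_full_torGeo_admissible` -/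

section InterD

variable {D : ℕ → Set (Fin d → ℤ)} {L M M₁ K : ℕ}

section Cover

omit [NeZero d]

/-- **The intersected domains** `Ω^∩_n`: the points ALL of whose deck translates lie in `Ω_n` — the largest deck-invariant family
of domains inside `Ω`; its large-field family `(Ω^∩_n)ᶜ` is the PERIODIZED large-field family `periodize (Ω_nᶜ)`
(`compl_interD`): the pull-back to the cover of the torus domains obtained by drawing the large fields of the cover on `T`.
[cite: Balaban1984PropagatorsI, Sect. A p.17; Balaban1984PropagatorsII, (2.1)–(2.4) p.224; Balaban1989LargeFieldI, (1.11) p.179] -/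
def interD (P : Fin d → ℕ) (D : ℕ → Set (Fin d → ℤ)) : ℕ → Set (Fin d → ℤ) :=
  fun n => {x | ∀ v : Fin d → ℤ, x - pmul P v ∈ D n}

/-- **Complements of the intersected domains = periodized large-field sets.** [cite: Balaban1984PropagatorsI, Sect. A p.17; Balaban1989LargeFieldI, (1.11) p.179] -/
theorem compl_interD (n : ℕ) : (interD P D n)ᶜ = periodize P (fun m => (D m)ᶜ) n := by
  ext x
  simp only [interD, periodize, Set.mem_compl_iff, Set.mem_setOf_eq, not_forall]

/-- The trivial translation vector. [folklore] -/
private theorem pmul_zero' (P : Fin d → ℕ) : pmul P (0 : Fin d → ℤ) = 0 := by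
  funext μ; simp [pmul]

/-- `Ω^∩_n ⊆ Ω_n`: no large-field point of the cover is lost (`Ω_nᶜ ⊆ (Ω^∩_n)ᶜ`). [cite: Balaban1989LargeFieldI, (1.11) p.179] -/
theorem interD_subset (n : ℕ) : interD P D n ⊆ D n := fun x hx => by
  have h := hx 0
  rwa [pmul_zero', sub_zero] at h

/-- **The intersected domains are deck invariant.** [cite: Balaban1984PropagatorsI, Sect. A p.17] -/
theorem interD_mem_iff (n : ℕ) (x v : Fin d → ℤ) : x + pmul P v ∈ interD P D n ↔ x ∈ interD P D n := by
  constructor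
  · intro h w
    have h' := h (w + v)
    convert h' using 1
    funext μ
    simp only [Pi.sub_apply, Pi.add_apply, pmul]
    ring
  · intro h w
    have h' := h (w - v)
    convert h' using 1
    funext μ
    simp only [Pi.sub_apply, Pi.add_apply, pmul]
    ring

/-- `Within` is translation invariant. [folklore] -/
private theorem within_sub_iff' {r : ℤ} {x y t : Fin d → ℤ} : Within r (x - t) (y - t) ↔ Within r x y := by
  simp only [Within, Pi.sub_apply, sub_sub_sub_cancel_right]

/-- **r11's separation property (2.13) survives intersecting the translates** (a translation-invariant local statement).
[cite: Balaban1988Convergent, (2.13) p.256; Balaban1984PropagatorsI, Sect. A p.17] -/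
theorem hdistD_interD
    (hdist : ∀ n, ∀ x ∈ D (n + 1), ∀ y, Within ((B14.Eq213MaximalDomains.side L M (n + 1) : ℤ) - 1) x y → y ∈ D n) :
    ∀ n, ∀ x ∈ interD P D (n + 1), ∀ y,
      Within ((B14.Eq213MaximalDomains.side L M (n + 1) : ℤ) - 1) x y → y ∈ interD P D n :=
  fun n _ hx _ hxy v => hdist n _ (hx v) _ (within_sub_iff'.mpr hxy)

/-- **Unions of partition cubes survive intersecting the translates** (cube side `s ∣ P_μ`: the deck translations permute the
cubes). [cite: Balaban1988Convergent, (2.13) p.256; Balaban1989LargeFieldI, p.179] -/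
theorem isUnionOfCubes_interD {s : ℕ} (hs : ∀ μ, s ∣ P μ) (hs0 : 0 < s) {n : ℕ} (hU : IsUnionOfCubes s (D n)) :
    IsUnionOfCubes s (interD P D n) := by
  intro x y hxy
  have key : ∀ v, cubeIdx s (x - pmul P v) = cubeIdx s (y - pmul P v) := fun v => by
    funext μ
    rw [cubeIdx_sub_pmul hs hs0, cubeIdx_sub_pmul hs hs0, hxy]
  exact forall_congr' fun v => hU _ _ (key v)

/-- `Ω_n = T ⇒ Ω^∩_n = T`. [cite: Balaban1984PropagatorsII, (2.1)–(2.4) p.224] -/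
theorem interD_univ {n : ℕ} (hn : D n = Set.univ) : interD P D n = Set.univ :=
  Set.eq_univ_of_forall fun _ _ => by rw [hn]; trivial

/-- `Ω_n = ∅ ⇒ Ω^∩_n = ∅`. [cite: Balaban1984PropagatorsII, (2.1)–(2.4) p.224] -/
theorem interD_empty {n : ℕ} (hn : D n = ∅) : interD P D n = ∅ :=
  Set.subset_empty_iff.mp fun x hx => by
    have h := interD_subset n hx
    rw [hn] at h
    exact h

/-- Above the termination index every domain of an admissible sequence is empty. [cite: Balaban1988Convergent, (2.13) p.256] -/
private theorem eq_empty_of_admissible (hL : 1 ≤ L) (hM : 1 ≤ M)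
    (hdist : ∀ n, ∀ x ∈ D (n + 1), ∀ y, Within ((B14.Eq213MaximalDomains.side L M (n + 1) : ℤ) - 1) x y → y ∈ D n)
    (hK : D (K + 1) = ∅) {n : ℕ} (hn : K < n) : D n = ∅ := by
  have hanti : ∀ m, D (K + 1 + m) ⊆ D (K + 1) := by
    intro m
    induction m with
    | zero => exact le_rfl
    | succ m ih => exact (subset_of_admissible hL hM hdist (K + 1 + m)).trans ih
  have h := hanti (n - (K + 1))
  rw [show K + 1 + (n - (K + 1)) = n by omega] at h
  exact Set.subset_empty_iff.mp (hK ▸ h)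

/-- **Intersecting the translates of a [III] (2.13)-admissible sequence with finitely many scales keeps the cube structure** at
every index (`Ω_{K+1} = ∅`, `L^K·M ∣ P_μ`, `L, M ≥ 1`). [cite: Balaban1988Convergent, (2.13) p.256; Balaban1984PropagatorsI, Sect. A p.17; Balaban1989LargeFieldI, p.179] -/
theorem isUnionOfCubes_interD_admissible
    (hdistD : ∀ n, ∀ x ∈ D (n + 1), ∀ y, Within ((B14.Eq213MaximalDomains.side L M (n + 1) : ℤ) - 1) x y → y ∈ D n)
    (hcubes : ∀ n, IsUnionOfCubes (B14.Eq213MaximalDomains.side L M n) (D n)) (hK : D (K + 1) = ∅)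
    (hdvdPK : ∀ μ, B14.Eq213MaximalDomains.side L M K ∣ P μ) (hMpos : 1 ≤ M) (hL : 1 ≤ L) (n : ℕ) :
    IsUnionOfCubes (B14.Eq213MaximalDomains.side L M n) (interD P D n) := by
  rcases Nat.lt_or_ge K n with hn | hn
  · rw [interD_empty (eq_empty_of_admissible hL hMpos hdistD hK hn)]
    intro x y _
    simp
  · refine isUnionOfCubes_interD (fun μ => (?_ : _ ∣ _).trans (hdvdPK μ)) (B14.Eq213MaximalDomains.side_pos hL hMpos n)
      (hcubes n)
    unfold B14.Eq213MaximalDomains.side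
    exact Nat.mul_dvd_mul_right (Nat.pow_dvd_pow L hn) M

/-- **THE PERIODICITY DATUM OF THE INTERSECTED DOMAINS**, CONSTRUCTED (`M₁ ∣ M`, `L^K·M ∣ P_μ`, `Ω_{K+1} = ∅`).
[cite: Balaban1984PropagatorsII, (2.1)–(2.4) p.224; Balaban1988Convergent, (2.13) p.256; Balaban1984PropagatorsI, Sect. A p.17] -/
theorem isPeriodic_interD
    (hdistD : ∀ n, ∀ x ∈ D (n + 1), ∀ y, Within ((B14.Eq213MaximalDomains.side L M (n + 1) : ℤ) - 1) x y → y ∈ D n)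
    (hK : D (K + 1) = ∅) (hP : ∀ μ, 0 < P μ) (hdvdPK : ∀ μ, B14.Eq213MaximalDomains.side L M K ∣ P μ) (hM₁ : 0 < M₁)
    (hMpos : 1 ≤ M) (hdvd : M₁ ∣ M) (hL : 1 ≤ L) :
    IsPeriodic M₁ L (fun n => (interD P D n)ᶜ) P :=
  isPeriodic_of_admissible (hdistD_interD hdistD) (interD_empty hK) interD_mem_iff hP
    (fun μ => ((by unfold B14.Eq213MaximalDomains.side; rw [mul_comm]; exact Nat.mul_dvd_mul_left _ hdvd) :
      M₁ * L ^ K ∣ B14.Eq213MaximalDomains.side L M K).trans (hdvdPK μ)) hM₁ hMpos hL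

end Cover

/-- **LEMMA 2.1 (2.60)–(2.63) WITH c₁″ ON THE TORUS WHOSE LARGE FIELDS ARE THE PERIODIZED LARGE FIELDS OF ANY [III]
(2.13)-ADMISSIBLE SEQUENCE OF THE COVER WITH FINITELY MANY SCALES** (domains = the intersected translates `interD`; large-field
family `= periodize (Ω_nᶜ)` by `compl_interD`, containing every large-field point of the cover by `interD_subset`) — r11's
admissibility data (`hdistD`, cube unions), `Ω₀ = T`, `Ω_{K+1} = ∅`, positive periods with `L^K·M ∣ P_μ`, and the numerics
`1 ≤ M₁`, `M₁ ∣ M`, `L ≥ 2`, `R·M_r ≤ M/M₁`, `2 ≤ M/M₁`, `δ₀ > 0`, 0 < α < 1, (2.59).  This is the faithful companion of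
`B15LatticeCubeTorus.lemma21_full_torGeo_periodize` announced in the header rider: bounded large fields of the cover stay
large fields of the torus instead of being swallowed by the far translates of the domains.
[cite: Balaban1984PropagatorsII, Lemma 2.1 (2.60)–(2.63) p.234, (2.1)–(2.4) p.224; Balaban1988Convergent, (2.13) p.256; Balaban1984PropagatorsI, Sect. A p.17; Balaban1989LargeFieldI, p.179; corrected] -/
theorem lemma21_full_torGeo_interD
    (hdistD : ∀ n, ∀ x ∈ D (n + 1), ∀ y, Within ((B14.Eq213MaximalDomains.side L M (n + 1) : ℤ) - 1) x y → y ∈ D n)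
    (hcubes : ∀ n, IsUnionOfCubes (B14.Eq213MaximalDomains.side L M n) (D n)) (h0 : D 0 = Set.univ) (hK : D (K + 1) = ∅)
    (hP : ∀ μ, 0 < P μ) (hdvdPK : ∀ μ, B14.Eq213MaximalDomains.side L M K ∣ P μ) (hM₁ : 0 < M₁) (hMpos : 1 ≤ M)
    (hdvd : M₁ ∣ M) (hL : 2 ≤ L) (F : Finset (TSite M₁ L (fun n => (interD P D n)ᶜ) P)) (kk : ℕ) (η R Mr : ℝ)
    (hRM : R * Mr ≤ ((M / M₁ : ℕ) : ℝ)) (hN : 2 ≤ M / M₁) {δ₀ : ℝ} (hδ : 0 < δ₀) :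
    ∀ α : ℝ, 0 < α → α < 1 → B6.Cond259 d δ₀ α R Mr →
      B6RandomWalk.Ineq260
          (torGeo (isPeriodic_interD hdistD hK hP hdvdPK hM₁ hMpos hdvd (by omega)) F kk η R Mr) δ₀ α ∧
        B6Lemma21Repaired.Ineq261With (B6Lemma21TwoScale.c1TwoScale d δ₀ α)
          (torGeo (isPeriodic_interD hdistD hK hP hdvdPK hM₁ hMpos hdvd (by omega)) F kk η R Mr) δ₀ α ∧
        B6Lemma21Repaired.Ineq262With (B6Lemma21TwoScale.c1TwoScale d δ₀ α)
          (torGeo (isPeriodic_interD hdistD hK hP hdvdPK hM₁ hMpos hdvd (by omega)) F kk η R Mr) δ₀ α ∧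
        B6Lemma21Repaired.Ineq263With (B6Lemma21TwoScale.c1TwoScale d δ₀ α)
          (torGeo (isPeriodic_interD hdistD hK hP hdvdPK hM₁ hMpos hdvd (by omega)) F kk η R Mr) δ₀ α :=
  lemma21_full_torGeo_admissible (hdistD_interD hdistD)
    (isUnionOfCubes_interD_admissible hdistD hcubes hK hdvdPK hMpos (by omega)) (interD_univ h0) (interD_empty hK) hM₁ hMpos
    hdvd hL _ F kk η R Mr hRM hN hδ

omit [NeZero d] in
/-- **EVERY SCALE OF THE COVER'S LARGE FIELDS DRAWN IN ONE PERIOD CELL SURVIVES ON THE TORUS**: a cover cube-site of zone `n`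
(its cube inside `Ω_n ∖ Ω_{n+1}`) all of whose non-trivial deck translates lie in `Ω_n` — the large fields of the other period
cells are elsewhere — projects to a torus cube-site of zone `n` for the intersected domains (for ANY periodicity datum `h`, e.g.
`isPeriodic_interD`): the faithfulness announced in the header rider, as a theorem.
[cite: Balaban1984PropagatorsII, (2.45) p.231, (2.1)–(2.4) p.224; Balaban1984PropagatorsI, Sect. A p.17; Balaban1989LargeFieldI, (1.11) p.179] -/
theorem exists_tsite_interD_of_cubeSite (h : IsPeriodic M₁ L (fun n => (interD P D n)ᶜ) P)
    (s : CubeSite M₁ L (fun n => (D n)ᶜ))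
    (hfar : ∀ v : Fin d → ℤ, v ≠ 0 → ∀ x ∈ cube M₁ L s.1.1 s.1.2, x - pmul P v ∈ D s.1.1) :
    ∃ a : TSite M₁ L (fun n => (interD P D n)ᶜ) P, zoneT a = zoneC s := by
  refine ⟨proj h ⟨s.1, fun x hx => ?_⟩, rfl⟩
  have hl := s.2 hx
  simp only [Set.mem_sdiff, Set.mem_compl_iff, not_not] at hl ⊢
  refine ⟨fun hI => hl.1 (interD_subset _ hI), fun v => ?_⟩
  by_cases hv : v = 0
  · subst hv
    rw [pmul_zero', sub_zero]
    exact hl.2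
  · exact hfar v hv x hx

end InterD

end Literature.MathematicalPhysics.QuantumFieldTheory.Balaban1983to89.B15LatticeCubeTorusNestedBoxes
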